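import Literature.MathematicalPhysics.QuantumFieldTheory.PlaqSystemClusterExpansion
import Literature.MathematicalPhysics.QuantumFieldTheory.StrongCouplingTorusSystem
import Literature.MathematicalPhysics.QuantumFieldTheory.Sweep1AreaLawProofs
import Summits.Ventures.LatticeQCDFlow.TrivializingMaps.WilsonFisherZerosExtensive
import Summits.Ventures.LatticeQCDFlow.TrivializingMaps.WilsonMeasureTrivializingMap

/-!
HONEST FRAMING: exact (Metropolis-corrected) sampling algorithms for lattice gauge theory; figures
of merit are autocorrelation/cost numbers at stated couplings and volumes; no continuum-physics
claim.

# WilsonZeroFreeKP — A CLOSED-FORM, VOLUME-UNIFORM ZERO-FREE DISC OF THE FINITE-VOLUME WILSON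
# PARTITION FUNCTION FOR EVERY COMPACT GAUGE GROUP, `|s| ≤ 1/(4e·M_ρ·(3^d d² + 1)²)`, AND THE
# EXTENSIVE FISHER-ZERO COUNT OF `SU(n)` WITH A CLOSED-FORM RADIUS (lean-2 GEN-8, ours)

Venture-side (OURS).  Cell `lqcd-flow` (pub-lqcd), unit `pub-lqcd-lean-2-g8`, 2026-08-22.

Part T21/T22 of the venture statement count the Fisher zeros of `Z_L(s) = ∫ D[U] e^{-sS_W}` outside a
volume-uniform zero-free radius: `∃ ρ > 0` (T21) or `ρ = 1/θ₁(d, n, B)` (T22), `θ₁` being the growth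
constant of the tree's THEOREM A — explicit, but an unevaluated finite expression in a basis `B` of
`𝔰𝔲(n)`.  This file gives a SECOND volume-uniform zero-free disc whose radius is a CLOSED FORM in
`(d, N)` alone, for EVERY compact gauge group, by docking Lüscher's complexified partition function onto
the Literature's convergent strong-coupling cluster expansion (Osterwalder–Seiler 1978, Thm. 3.7;
Kotecký–Preiss 1986; the tree's `PlaqSystem.partZ_ne_zero_of_small` for the torus plaquette system
`torusSystem ρ L` of `StrongCouplingTorusSystem`, regular with `M = costBound ρ`, `D = 3^d d²`):

* §1 `torusSystem_partZ_genuine_eq_complexMGF` — the docking identity: the partition function of the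
  torus plaquette system with all genuine plaquettes switched on IS `Z_L(s) = complexMGF (-S_W) D[U] s`
  (`wilsonAction_torusSigma` + `map_torusSigma_zdHaar`), every complex `s`;
* §2 **`wilsonZ_ne_zero_of_small`** — for `G` compact, `ρ` continuous, EVERY `d`, EVERY `L ≥ 1`:
  `Z_L(s) ≠ 0` whenever `‖s‖·M_ρ ≤ 1` and `e·(2M_ρ‖s‖)·(3^d d² + 1)² ≤ ½`; for unitary-valued `ρ`
  (`M_ρ ≤ max 1 (2N)`, `costBound_le_of_unitary`) the closed form
  **`wilsonZ_zeroFree_explicit`: `Z_L(s) ≠ 0` for `‖s‖ ≤ 1/(4e · max(1, 2N) · (3^d d² + 1)²)`** —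
  `U(1)`, `U(N)`, `SU(N)`, `SO(N)`, `ℤ_N`, adjoint representations, … at once;
* §3 `SU(n)` in the venture's vocabulary: **`wilson_actionZ_zeroFree_kp`** — `Z_L(s) ≠ 0` for
  `‖s‖ ≤ r(d, n) := 1/(8e·n·(3^d d² + 1)²)`, every `L` (`n ≥ 1`); hence, by
  `wilson_fisherZeros_extensive_of_zeroFree`, **`wilson_fisherZeros_extensive_kp`**: for `n ≥ 2`,
  every `L ≥ 2`, every `R > 0`, the zeros `u` of `Z_L` with `r(d, n) ≤ |u| < R` have total
  multiplicity at least `r(d, n)² · (m₂(n) − 4n/R) · #plaquettes` — Part T21's count with a radius that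
  is a pure number; `wilson_su2_fisherZeros_extensive_kp` (`m₂(2) = 1`).

So both constants of the extensive-zeros law are now closed forms: the zeros lie in `r(d,n) ≤ |u|`, one
within `|u| ≤ 8` (`SU(2)`) / `8n` (T17), and at least `r(d,n)²(m₂(n) − 4n/R)·#plaq` of them in
`|u| < R`.  The radius `r(d, n)` is small (`d = 4`: `(3^4·16 + 1)² = 1297²`), but it depends on
nothing but `d` and `n` and holds in every volume.  NOT CLAIMED: that `r(d, n)` or `1/θ₁` is optimal
(neither is; the true zero-free radius is a physical quantity this file does not locate); any count
for a concrete volume; `β ≠ 0` recentring; cost / autocorrelation / continuum statements.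
Literature grade (cell rule): known mechanism (strong-coupling analyticity, [OsterwalderSeilerAnnPhys1978]
Thm. 3.7, [KoteckyPreiss1986]) docked onto the venture's objects; the Fisher-zero COUNT with a
closed-form radius is new typing, no new theorem of physics.
-/

noncomputable section

open MeasureTheory ProbabilityTheory Complex Metric Set Filter Topology MeromorphicOn
open Literature.MathematicalPhysics.QuantumFieldTheory
open Literature.MathematicalPhysics.QuantumFieldTheory.Luscher2010
open Literature.MathematicalPhysics.QuantumFieldTheory.WilsonFlow (coeConfig continuous_coeConfig)
open scoped Matrix Matrix.Norms.Frobenius ContDiff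

namespace Summit.Ventures.LatticeQCDFlow.TrivializingMaps

/-! ## §1 Docking: the torus plaquette system's partition function is `Z_L` -/

section AnyGroup

variable {d L N : ℕ} [NeZero L] {G : Type*} [Group G] [TopologicalSpace G] [IsTopologicalGroup G]
  [CompactSpace G] [MeasurableSpace G] [BorelSpace G] (ρ : G →* Matrix (Fin N) (Fin N) ℂ)

/-- **Docking identity.**  The partition function of the torus plaquette system
(`StrongCouplingTorusSystem.torusSystem ρ L`, an integral over the infinite Haar product `zdHaar d G`
read through the section `torusSigma L`) with all genuine torus plaquettes switched on equals Lüscher's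
complexified Wilson partition function `Z_L(s) = ∫ D[U] e^{-sS_W} = complexMGF (-S_W) D[U] s`, for every
complex `s`. [ours] -/
theorem torusSystem_partZ_genuine_eq_complexMGF (hρ : Continuous ρ) (s : ℂ) :
    (torusSystem ρ L).partZ (torusGenuine d L) s =
      complexMGF (fun U => -wilsonAction ρ U) (trivialMeasure G d L) s := by
  rw [PlaqSystem.partZ, PlaqSystem.numZ_eq_integral_exp, WilsonPinching.complexMGF_neg_wilsonAction]
  have hπ : trivialMeasure G d L = (zdHaar d G).map (torusSigma L) := by
    rw [map_torusSigma_zdHaar]; rfl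
  have hmS : Measurable (wilsonAction (d := d) (L := L) (G := G) ρ) :=
    WilsonRP.measurable_wilsonAction ρ hρ
  have hsm : AEStronglyMeasurable (fun V : GaugeConfig d L G => cexp (-(s * (wilsonAction ρ V : ℂ))))
      ((zdHaar d G).map (torusSigma L)) :=
    (Complex.measurable_exp.comp
      ((Complex.measurable_ofReal.comp hmS).const_mul s).neg).aestronglyMeasurable
  rw [hπ, integral_map (measurable_torusSigma L).aemeasurable hsm]
  refine integral_congr_ae (ae_of_all _ fun U => ?_)
  simp only [one_mul, torusSystem_cost, wilsonAction_torusSigma]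
  push_cast
  rfl

/-! ## §2 The zero-free disc for every compact gauge group -/

/-- **`Z_L(s) ≠ 0` at strong complex coupling, every volume** (Kotecký–Preiss disc of the torus
plaquette system): for `G` compact, `ρ` continuous, every `d` and every `L ≥ 1`, if `‖s‖·M_ρ ≤ 1` and
`e·(2M_ρ‖s‖)·(3^d d² + 1)² ≤ ½` (`M_ρ = costBound ρ`), then `∫ D[U] e^{-sS_W} ≠ 0`. [ours; mechanism:
cite OsterwalderSeilerAnnPhys1978 Thm. 3.7, KoteckyPreiss1986] -/
theorem wilsonZ_ne_zero_of_small (hρ : Continuous ρ) {s : ℂ} (h1 : ‖s‖ * costBound ρ ≤ 1)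
    (h2 : Real.exp 1 * (2 * costBound ρ * ‖s‖) * ((Plaq.degBound d : ℝ) + 1) ^ 2 ≤ 1 / 2) :
    complexMGF (fun U => -wilsonAction ρ U) (trivialMeasure G d L) s ≠ 0 := by
  rw [← torusSystem_partZ_genuine_eq_complexMGF ρ hρ s]
  exact PlaqSystem.partZ_ne_zero_of_small (torusSystem_regular ρ hρ) h1 h2 _

/-- The same in Lüscher's integral notation: `∫ D[U] e^{-sS_W} ≠ 0`. [ours] -/
theorem wilsonZ_integral_ne_zero_of_small (hρ : Continuous ρ) {s : ℂ} (h1 : ‖s‖ * costBound ρ ≤ 1)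
    (h2 : Real.exp 1 * (2 * costBound ρ * ‖s‖) * ((Plaq.degBound d : ℝ) + 1) ^ 2 ≤ 1 / 2) :
    ∫ U, cexp (-(s * (wilsonAction ρ U : ℂ))) ∂(trivialMeasure G d L) ≠ 0 := by
  rw [← WilsonPinching.complexMGF_neg_wilsonAction ρ s]
  exact wilsonZ_ne_zero_of_small ρ hρ h1 h2

omit [NeZero L] [TopologicalSpace G] [IsTopologicalGroup G] [CompactSpace G] [MeasurableSpace G]
  [BorelSpace G] in
/-- For a unitary-valued matrix representation the cost constant obeys `M_ρ ≤ max 1 (2N)`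
(`|N − Re tr ρ(g)| ≤ 2N`). [ours] -/
theorem costBound_le_of_unitary (hρu : ∀ g, ρ g ∈ Matrix.unitaryGroup (Fin N) ℂ) :
    costBound ρ ≤ max 1 (2 * (N : ℝ)) := by
  unfold costBound
  haveI : Nonempty G := ⟨1⟩
  refine max_le_max (le_refl (1 : ℝ)) (ciSup_le fun g : G => ?_)
  have h := abs_re_trace_le_of_mem_unitaryGroup (hρu g)
  rw [abs_le] at h ⊢
  constructor <;> linarith [h.1, h.2]

/-- `(3^d d² : ℕ)` cast: `(Plaq.degBound d : ℝ) = 3^d · d²`. [ours] -/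
theorem cast_degBound (d : ℕ) : (Plaq.degBound d : ℝ) = (3 : ℝ) ^ d * (d : ℝ) ^ 2 := by
  unfold Plaq.degBound; push_cast; ring

/-- **CLOSED-FORM VOLUME-UNIFORM ZERO-FREE DISC, EVERY COMPACT GAUGE GROUP.**  For `G` compact, `ρ` a
continuous unitary-valued `N`-dimensional matrix representation, every `d`, EVERY `L ≥ 1` and every
complex `s` with `‖s‖ ≤ 1 / (4e · max(1, 2N) · (3^d d² + 1)²)`:
`Z_L(s) = ∫ D[U] e^{-sS_W} ≠ 0`. [ours] -/
theorem wilsonZ_zeroFree_explicit (hρ : Continuous ρ) (hρu : ∀ g, ρ g ∈ Matrix.unitaryGroup (Fin N) ℂ)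
    (s : ℂ) (hs : ‖s‖ ≤ 1 / (4 * Real.exp 1 * max 1 (2 * (N : ℝ)) * ((3 : ℝ) ^ d * (d : ℝ) ^ 2 + 1) ^ 2)) :
    complexMGF (fun U => -wilsonAction ρ U) (trivialMeasure G d L) s ≠ 0 := by
  set M' : ℝ := max 1 (2 * (N : ℝ)) with hM'
  set K : ℝ := ((3 : ℝ) ^ d * (d : ℝ) ^ 2 + 1) ^ 2 with hK
  have hM'1 : 1 ≤ M' := le_max_left _ _
  have hM'0 : 0 < M' := one_pos.trans_le hM'1
  have hK1 : 1 ≤ K := by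
    rw [hK]; nlinarith [show (0 : ℝ) ≤ (3 : ℝ) ^ d * (d : ℝ) ^ 2 by positivity]
  have hK0 : 0 < K := one_pos.trans_le hK1
  have he1 : 1 ≤ Real.exp 1 := Real.one_le_exp zero_le_one
  have he0 : 0 < Real.exp 1 := Real.exp_pos 1
  have hMle : costBound ρ ≤ M' := costBound_le_of_unitary ρ hρu
  have hM0 : 0 < costBound ρ := costBound_pos ρ
  have hDK : ((Plaq.degBound d : ℝ) + 1) ^ 2 = K := by rw [cast_degBound]
  have hs0 : 0 ≤ ‖s‖ := norm_nonneg s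
  -- `‖s‖ · (4 e M' K) ≤ 1`
  have hprod : ‖s‖ * (4 * Real.exp 1 * M' * K) ≤ 1 := by
    have hpos : 0 < 4 * Real.exp 1 * M' * K := by positivity
    calc ‖s‖ * (4 * Real.exp 1 * M' * K) ≤ 1 / (4 * Real.exp 1 * M' * K) * (4 * Real.exp 1 * M' * K) :=
          mul_le_mul_of_nonneg_right hs hpos.le
      _ = 1 := div_mul_cancel₀ 1 hpos.ne'
  refine wilsonZ_ne_zero_of_small ρ hρ ?_ ?_
  · -- `‖s‖ M_ρ ≤ ‖s‖ M' ≤ 1`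
    calc ‖s‖ * costBound ρ ≤ ‖s‖ * M' := mul_le_mul_of_nonneg_left hMle hs0
      _ ≤ ‖s‖ * (4 * Real.exp 1 * M' * K) := by
          refine mul_le_mul_of_nonneg_left ?_ hs0
          calc M' = 1 * 1 * M' * 1 := by ring
            _ ≤ 4 * Real.exp 1 * M' * K := by gcongr; norm_num
      _ ≤ 1 := hprod
  · rw [hDK]
    calc Real.exp 1 * (2 * costBound ρ * ‖s‖) * K ≤ Real.exp 1 * (2 * M' * ‖s‖) * K := by gcongr
      _ = (‖s‖ * (4 * Real.exp 1 * M' * K)) / 2 := by ring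
      _ ≤ 1 / 2 := by gcongr

/-- Lüscher's notation: `∫ D[U] e^{-sS_W} ≠ 0` on the closed-form disc. [ours] -/
theorem wilsonZ_integral_zeroFree_explicit (hρ : Continuous ρ)
    (hρu : ∀ g, ρ g ∈ Matrix.unitaryGroup (Fin N) ℂ) (s : ℂ)
    (hs : ‖s‖ ≤ 1 / (4 * Real.exp 1 * max 1 (2 * (N : ℝ)) * ((3 : ℝ) ^ d * (d : ℝ) ^ 2 + 1) ^ 2)) :
    ∫ U, cexp (-(s * (wilsonAction ρ U : ℂ))) ∂(trivialMeasure G d L) ≠ 0 := by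
  rw [← WilsonPinching.complexMGF_neg_wilsonAction ρ s]
  exact wilsonZ_zeroFree_explicit ρ hρ hρu s hs

end AnyGroup

/-! ## §3 `SU(n)`: the closed-form radius `r(d, n) = 1/(8e·n·(3^d d² + 1)²)` and the extensive count -/

section SU

variable {d n : ℕ}

/-- The closed-form `SU(n)` radius `r(d, n) = 1/(8e·n·(3^d d² + 1)²)` is positive (`n ≥ 1`). [ours] -/
theorem kpRadius_pos (hn : 1 ≤ n) :
    0 < 1 / (8 * Real.exp 1 * (n : ℝ) * ((3 : ℝ) ^ d * (d : ℝ) ^ 2 + 1) ^ 2) := by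
  have : (0 : ℝ) < n := by exact_mod_cast hn
  positivity

/-- **`SU(n)`, CLOSED-FORM VOLUME-UNIFORM ZERO-FREE DISC**: for `n ≥ 1`, every `d`, EVERY `L ≥ 1` and
every `s` with `‖s‖ ≤ 1/(8e·n·(3^d d² + 1)²)`, the `SU(n)` Wilson partition function
`Z_L(s) = ∫ D[U] e^{-sS_W}` (Lüscher's ambient action on `SU(n)^E`) is non-zero. [ours] -/
theorem wilson_actionZ_zeroFree_kp (hn : 1 ≤ n) (L : ℕ) [NeZero L] (s : ℂ)
    (hs : ‖s‖ ≤ 1 / (8 * Real.exp 1 * (n : ℝ) * ((3 : ℝ) ^ d * (d : ℝ) ^ 2 + 1) ^ 2)) :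
    complexMGF (fun U => -ambWilsonAction (coeConfig U))
      (trivialMeasure (Matrix.specialUnitaryGroup (Fin n) ℂ) d L) s ≠ 0 := by
  have hfun : (fun U : GaugeConfig d L (Matrix.specialUnitaryGroup (Fin n) ℂ) =>
      -ambWilsonAction (coeConfig U)) = fun U => -wilsonAction (StrongCoupling.defRep n) U := by
    funext U; rw [StrongCoupling.ambWilsonAction_coeConfig]
  rw [hfun]
  have hmax : max 1 (2 * (n : ℝ)) = 2 * n := by
    refine max_eq_right ?_
    have : (1 : ℝ) ≤ n := by exact_mod_cast hn
    linarith
  refine wilsonZ_zeroFree_explicit (StrongCoupling.defRep n) continuous_subtype_val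
    (fun g => (Matrix.mem_specialUnitaryGroup_iff.1 g.2).1) s ?_
  rw [hmax]
  calc ‖s‖ ≤ 1 / (8 * Real.exp 1 * (n : ℝ) * ((3 : ℝ) ^ d * (d : ℝ) ^ 2 + 1) ^ 2) := hs
    _ = 1 / (4 * Real.exp 1 * (2 * (n : ℝ)) * ((3 : ℝ) ^ d * (d : ℝ) ^ 2 + 1) ^ 2) := by ring

/-- **`SU(n)`: EXTENSIVE FISHER ZEROS WITH A CLOSED-FORM RADIUS.**  For `n ≥ 2`, every `d`, every
`L ≥ 2` and every `R > 0`, with `r = 1/(8e·n·(3^d d² + 1)²)`: the `SU(n)` Wilson partition function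
`Z_L` has a finite set `T` of zeros `u` with `r ≤ |u| < R`, each of multiplicity
`divisor Z_L (closedBall 0 (2R)) u ≥ 1`, of total multiplicity at least
`r² · (m₂(n) − 4n/R) · #plaquettes(d, L)`, `m₂(n) = ∫_{SU(n)} (Re tr)² dHaar`. [ours] -/
theorem wilson_fisherZeros_extensive_kp (hn : 2 ≤ n) (L : ℕ) [NeZero L] (hL : 2 ≤ L) (R : ℝ)
    (hR : 0 < R) :
    ∃ T : Finset ℂ, (∀ u ∈ T,
        complexMGF (fun U => -ambWilsonAction (coeConfig U))
            (trivialMeasure (Matrix.specialUnitaryGroup (Fin n) ℂ) d L) u = 0 ∧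
          1 / (8 * Real.exp 1 * (n : ℝ) * ((3 : ℝ) ^ d * (d : ℝ) ^ 2 + 1) ^ 2) ≤ ‖u‖ ∧ ‖u‖ < R ∧
          1 ≤ divisor (complexMGF (fun U => -ambWilsonAction (coeConfig U))
            (trivialMeasure (Matrix.specialUnitaryGroup (Fin n) ℂ) d L)) (closedBall (0 : ℂ) (2 * R)) u) ∧
      (1 / (8 * Real.exp 1 * (n : ℝ) * ((3 : ℝ) ^ d * (d : ℝ) ^ 2 + 1) ^ 2)) ^ 2 *
          ((∫ g, ((g : Matrix (Fin n) (Fin n) ℂ)).trace.re ^ 2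
            ∂(haarProbability (Matrix.specialUnitaryGroup (Fin n) ℂ))) - 4 * n / R) *
          Fintype.card (Plaquette d L) ≤
        ∑ u ∈ T, (divisor (complexMGF (fun U => -ambWilsonAction (coeConfig U))
            (trivialMeasure (Matrix.specialUnitaryGroup (Fin n) ℂ) d L)) (closedBall (0 : ℂ) (2 * R)) u
          : ℝ) :=
  wilson_fisherZeros_extensive_of_zeroFree hn (kpRadius_pos (d := d) (by omega)) L hL
    (fun s hs => wilson_actionZ_zeroFree_kp (by omega) L s hs.le) R hR

/-- **`SU(2)` (`m₂ = 1`): at least `r²·(1 − 8/R)·#plaq` Fisher zeros (with multiplicity) with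
`r ≤ |u| < R`, `r = 1/(16e·(3^d d² + 1)²)`, every `L ≥ 2`.** [ours] -/
theorem wilson_su2_fisherZeros_extensive_kp (L : ℕ) [NeZero L] (hL : 2 ≤ L) (R : ℝ) (hR : 0 < R) :
    ∃ T : Finset ℂ, (∀ u ∈ T,
        complexMGF (fun U => -ambWilsonAction (coeConfig U))
            (trivialMeasure (Matrix.specialUnitaryGroup (Fin 2) ℂ) d L) u = 0 ∧
          1 / (16 * Real.exp 1 * ((3 : ℝ) ^ d * (d : ℝ) ^ 2 + 1) ^ 2) ≤ ‖u‖ ∧ ‖u‖ < R ∧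
          1 ≤ divisor (complexMGF (fun U => -ambWilsonAction (coeConfig U))
            (trivialMeasure (Matrix.specialUnitaryGroup (Fin 2) ℂ) d L)) (closedBall (0 : ℂ) (2 * R)) u) ∧
      (1 / (16 * Real.exp 1 * ((3 : ℝ) ^ d * (d : ℝ) ^ 2 + 1) ^ 2)) ^ 2 * (1 - 8 / R) *
          Fintype.card (Plaquette d L) ≤
        ∑ u ∈ T, (divisor (complexMGF (fun U => -ambWilsonAction (coeConfig U))
            (trivialMeasure (Matrix.specialUnitaryGroup (Fin 2) ℂ) d L)) (closedBall (0 : ℂ) (2 * R)) u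
          : ℝ) := by
  obtain ⟨T, hT, hsum⟩ := wilson_fisherZeros_extensive_kp (d := d) (n := 2) le_rfl L hL R hR
  have hr : 1 / (8 * Real.exp 1 * ((2 : ℕ) : ℝ) * ((3 : ℝ) ^ d * (d : ℝ) ^ 2 + 1) ^ 2) =
      1 / (16 * Real.exp 1 * ((3 : ℝ) ^ d * (d : ℝ) ^ 2 + 1) ^ 2) := by
    push_cast; ring
  refine ⟨T, fun u hu => ?_, ?_⟩
  · obtain ⟨h1, h2, h3, h4⟩ := hT u hu
    exact ⟨h1, hr ▸ h2, h3, h4⟩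
  · rw [haarSqReTrace_su2] at hsum
    rw [← hr]
    have : (1 : ℝ) - 4 * (2 : ℕ) / R = 1 - 8 / R := by norm_num
    rwa [this] at hsum

end SU

end Summit.Ventures.LatticeQCDFlow.TrivializingMaps
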